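import Summits.SmoothPoincare4.Statement
import Literature.Topology.FourManifolds.HomotopySpheres
import Literature.Geometry.Riemannian.IsotropicCurvature
import Literature.Geometry.Lorentzian.LeviCivita

/-!
# SmoothPoincare4 / PIC — assembly of the positive-isotropic-curvature route

Problem `SmoothPoincare4`, topic `PIC` (item stmt-SmoothPoincare4-0474). Hypotheses: (hH) the
Hamilton–Chen–Tang–Zhu theorem in the simply connected case (a compact simply connected smooth
4-manifold with a Riemannian metric of positive isotropic curvature is diffeomorphic to `S⁴`;
Hamilton 1997, Thm. 1.1; Chen–Tang–Zhu 2012, Thm. 1.1), (hSC) homotopy `S⁴` ⇒ simply connected,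
(hX) the route thesis: every homotopy 4-sphere carries a Riemannian PIC metric. Conclusion: every
`S : Literature.HomotopySphere 4` is diffeomorphic to `S⁴` (the input of the reduction
stmt-SmoothPoincare4-0441). Six-line bookkeeping.
-/

open scoped Manifold ContDiff
open ContinuousMap

namespace Literature.SPC4

/-- Settles stmt-SmoothPoincare4-0474: (Hamilton–Chen–Tang–Zhu, π₁ = 1 case) → (homotopy `S⁴` ⇒
simply connected) → (every homotopy 4-sphere has a Riemannian PIC metric) → every homotopy
4-sphere is diffeomorphic to `S⁴`. [Hamilton 1997, Thm. 1.1; Chen–Tang–Zhu 2012, Thm. 1.1 (as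
hypothesis)] [folklore] -/
theorem forall_homotopySphere_of_pic
    (hH : ∀ (M : Type) [TopologicalSpace M] [T2Space M] [SecondCountableTopology M]
      [ChartedSpace (EuclideanSpace ℝ (Fin 4)) M] [IsManifold (𝓡 4) ∞ M] [CompactSpace M]
      [SimplyConnectedSpace M],
      (∃ g : Literature.Geometry.Lorentzian.PseudoRiemannianMetric (𝓡 4) ∞ (EuclideanSpace ℝ (Fin 4))
        (TangentSpace (𝓡 4) : M → Type _), g.IsRiemannian ∧ g.HasPositiveIsotropicCurvature) →
      Nonempty (M ≃ₘ⟮𝓡 4, 𝓡 4⟯ Metric.sphere (0 : EuclideanSpace ℝ (Fin 5)) 1))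
    (hSC : ∀ (M : Type) [TopologicalSpace M],
      M ≃ₕ Metric.sphere (0 : EuclideanSpace ℝ (Fin 5)) 1 → SimplyConnectedSpace M)
    (hX : ∀ S : Literature.Topology.FourManifolds.HomotopySphere 4,
      ∃ g : Literature.Geometry.Lorentzian.PseudoRiemannianMetric (𝓡 4) ∞ (EuclideanSpace ℝ (Fin 4))
        (TangentSpace (𝓡 4) : S.carrier → Type _), g.IsRiemannian ∧ g.HasPositiveIsotropicCurvature) :
    ∀ S : Literature.Topology.FourManifolds.HomotopySphere 4,
      Nonempty (S.carrier ≃ₘ⟮𝓡 4, 𝓡 4⟯ Metric.sphere (0 : EuclideanSpace ℝ (Fin 5)) 1) := by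
  intro S
  obtain ⟨e⟩ := S.nonempty_homotopyEquiv
  haveI := hSC S.carrier e
  exact hH S.carrier (hX S)

end Literature.SPC4
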